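import Literature.NumberTheory.Automorphic.StableCentralizerEquiv
import Literature.NumberTheory.Automorphic.OrbitalMeasureFamilyRegular
import Literature.NumberTheory.Automorphic.UnitaryGroupAdelicOrbitalMeasure
import Literature.LinearAlgebra.Matrix.CentraliserOfSeparableCharpoly
import HarnessLib

/-!
# Stably conjugate regular elements have canonically isomorphic centralisers, II: the CM carriers (local, adelic from rational data, archimedean)
(Rogawski, *Automorphic representations of unitary groups in three variables* (1990), §3.1 p. 19, §4.3 pp. 43–44, §14.1 p. 232)

Topic `NumberTheory/Automorphic`; namespace `Literature.NumberTheory.Automorphic.UnitaryGroup`.  DEFINITIONS WITH BODIES + THEOREMS (no named fact, no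
instance, no `sorry`).  Sequel of ★ `StableCentralizerEquiv` (generic `Corresponds.centralizer[Continuous]Equiv` under the hypothesis `hcomm` «the
`GL_n`-commutant of `γ` is commutative»): here `hcomm` is DISCHARGED from ★ `IsRegularElt` (separable characteristic polynomial) on the three carriers of
the F0/P3a line, giving the data (M-C-2) ∕ (M-C-4) of road (M-C) «MEASURE COHERENCE» transport measures along (plus the `H′ = H` name
`IsStablyConj.centralizerEquiv` announced in ★ `StableCentralizerEquiv`):

* LOCAL **`localStableCentralizerEquiv`**: `γ ∈ (cmDatum L N H).Local v`, `γ′ ∈ (cmDatum L N H′).Local v`, `γ ↔ γ′` (★ `Corresponds` over `∏_{w∣v} L_w`)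
  ⇒ `Z(γ) ≃ₜ* Z(γ′)` (★ `commute_of_charpoly_separable_pi`); `coe_localStableCentralizerEquiv_eq_of_conj_eq` (it is conjugation by ANY conjugator).
* ADELIC from RATIONAL data **`adelicStableCentralizerEquiv`**: `γ ∈ U(H)(L⁺)`, `γ′ ∈ U(H′)(L⁺)` corresponding over `L` (conjugate in `GL_N(L)`), `γ`
  regular ⇒ `Z_{U(H)(𝔸)}(γ ⊗ 1) ≃ₜ* Z_{U(H′)(𝔸)}(γ′ ⊗ 1)` (conjugator `x ⊗ 1`, ★ `commute_of_commute_map_of_charpoly_separable`);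
  `corresponds_toAdelic`, `coe_adelicStableCentralizerEquiv_eq_of_conj_eq`; the RATIONAL twin **`rationalStableCentralizerEquiv`**
  (`Z_{U(H)(L⁺)}(γ) ≃* Z_{U(H′)(L⁺)}(γ′)`), the compatibility **`adelicStableCentralizerEquiv_toAdelic`** (`e_𝔸 (z ⊗ 1) = (e_L z) ⊗ 1`) and the
  lattice statement **`adelicStableCentralizerEquiv_mem_arithmeticSubgroup_iff`** (`e_𝔸 z` is rational iff `z` is: `e_𝔸(Z_γ(L⁺)) = Z_{γ′}(L⁺)`, the
  hypothesis shape of ★ `quotientMeasure_univ_eq_of_mulEquiv` for the covolumes `m(Z_γ(L⁺) \ Z_γ(𝔸))` of (M-C-4)).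
* ARCHIMEDEAN **`archStableCentralizerEquiv`** on `UnitaryGroup.arch` (★ `commute_of_commute_of_charpoly_separable_of_injective` through
  `L ⊗ ℝ ↪ ℂ^{r₁ ⊔ r₂}`, `mixedSpace_pi_injective`); `coe_archStableCentralizerEquiv_eq_of_conj_eq`.

## References
* J. D. Rogawski, *Automorphic Representations of Unitary Groups in Three Variables*, Ann. of Math. Stud. 123 (1990), §3.1 p. 19, §4.3 pp. 43–44,
  §14.1 p. 232, §14.5 pp. 237–238 [Rogawski1990].
* R. P. Langlands, D. Shelstad, *On the definition of transfer factors*, Math. Ann. 278 (1987), §1.3 [LanglandsShelstad1987].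
-/

noncomputable section

open NumberField IsDedekindDomain
open scoped Matrix MatrixGroups

namespace Literature.NumberTheory.Automorphic

namespace UnitaryGroup

open Literature.LinearAlgebra.Matrix Literature.NumberTheory.Rogawski1990
open NumberField.InfinitePlace

/-! ### `H′ = H`: stable conjugacy (the name announced in ★ `StableCentralizerEquiv`'s docstring) -/

/-- **`Z_{U(H)}(γ) ≃* Z_{U(H)}(δ)` for STABLY CONJUGATE regular `γ, δ`** — ★ `Corresponds.centralizerEquiv` in the case `H′ = H`
(★ `IsStablyConj σ H γ δ` is `Corresponds σ H H γ δ`, ★ `corresponds_self_iff`). [cite: Rogawski1990, §3.1 p. 19; §4.3 pp. 43–44] -/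
def _root_.Literature.NumberTheory.Rogawski1990.IsStablyConj.centralizerEquiv {R : Type*} [CommRing R] {n : Type*} [Fintype n] [DecidableEq n]
    {σ : R →+* R} {H : Matrix n n R} {γ δ : Literature.AlgebraicGeometry.ShimuraVarieties.unitaryGroup σ H} (hc : IsStablyConj σ H γ δ)
    (hH : IsUnit H)
    (hcomm : ∀ B C : Matrix n n R, Commute B ((γ : GL n R) : Matrix n n R) → Commute C ((γ : GL n R) : Matrix n n R) → Commute B C)
    (hcomm' : ∀ B C : Matrix n n R, Commute B ((δ : GL n R) : Matrix n n R) → Commute C ((δ : GL n R) : Matrix n n R) → Commute B C) :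
    Subgroup.centralizer ({γ} : Set (Literature.AlgebraicGeometry.ShimuraVarieties.unitaryGroup σ H)) ≃*
      Subgroup.centralizer ({δ} : Set (Literature.AlgebraicGeometry.ShimuraVarieties.unitaryGroup σ H)) :=
  Corresponds.centralizerEquiv (corresponds_self_iff.mpr hc) hH hH hcomm hcomm'

variable (L : Type) [Field L] [NumberField L] [IsCMField L] {N : ℕ} {H H' : Matrix (Fin N) (Fin N) L}

omit [NumberField L] [IsCMField L] in
/-- A matrix with `det ≠ 0` over the field `L` stays invertible after any base change `L →+* S`. [cite: Rogawski1990, §3.1 p. 19] -/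
theorem isUnit_map_of_det_ne_zero {S : Type*} [CommRing S] (f : L →+* S) (hdet : H.det ≠ 0) : IsUnit (H.map f) := by
  rw [Matrix.isUnit_iff_isUnit_det, ← RingHom.mapMatrix_apply, ← RingHom.map_det]
  exact (isUnit_iff_ne_zero.mpr hdet).map f

/-! ### Local: `U(H)(L⁺_v)`, `U(H′)(L⁺_v) ≤ GL_N(∏_{w∣v} L_w)` -/

section Local

variable (v : HeightOneSpectrum (𝓞 ↥(maximalRealSubfield L)))

omit [IsCMField L] in
/-- The local form `H_v = (H ⊗ 1)_v` is invertible for `det H ≠ 0`. [cite: Rogawski1990, §3.1 p. 19] -/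
theorem isUnit_adelicForm_map_adeleToLocal (hH : H.det ≠ 0) : IsUnit ((adelicForm L N H).map (adeleToLocal L v)) := by
  rw [adelicForm, Matrix.map_map, ← RingHom.coe_comp]
  exact isUnit_map_of_det_ne_zero L ((adeleToLocal L v).comp (algebraMap L (AdeleRing (𝓞 L) L))) hH

/-- The `GL_N(∏_{w∣v} L_w)`-commutant of a regular local element is commutative (★ `commute_of_charpoly_separable_pi`).
[cite: Rogawski1990, §3.1 p. 19] -/
theorem commute_of_commute_of_isRegularElt_local (γ : (cmDatum L N H).Local v) (hγ : IsRegularElt (γ.val : GL (Fin N) (LocalRing L v))) :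
    ∀ B C : Matrix (Fin N) (Fin N) (LocalRing L v), Commute B (γ.val : GL (Fin N) (LocalRing L v)).val →
      Commute C (γ.val : GL (Fin N) (LocalRing L v)).val → Commute B C :=
  fun _ _ hB hC => commute_of_charpoly_separable_pi _ hγ hB.symm hC.symm

/-- **LOCAL `Z_{G′_v}(γ′) ≃ₜ* Z_{G_v}(γ)`**: for `γ ∈ U(H)(L⁺_v)`, `γ′ ∈ U(H′)(L⁺_v)` with `γ ↔ γ′` (★ `Corresponds` over `∏_{w∣v} L_w`) and `γ`
regular (`det H, det H′ ≠ 0`), the conjugator-independent isomorphism of their centralisers. [cite: Rogawski1990, §4.3 pp. 43–44] -/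
def localStableCentralizerEquiv (hH : H.det ≠ 0) (hH' : H'.det ≠ 0) {γ : (cmDatum L N H).Local v} {γ' : (cmDatum L N H').Local v}
    (hc : Corresponds (conjLocal L (IsCMField.complexConj L) v) ((adelicForm L N H).map (adeleToLocal L v))
      ((adelicForm L N H').map (adeleToLocal L v)) γ γ')
    (hγ : IsRegularElt (γ.val : GL (Fin N) (LocalRing L v))) :
    Subgroup.centralizer ({γ} : Set ((cmDatum L N H).Local v)) ≃ₜ* Subgroup.centralizer ({γ'} : Set ((cmDatum L N H').Local v)) :=
  hc.centralizerContinuousEquiv (isUnit_adelicForm_map_adeleToLocal L v hH) (isUnit_adelicForm_map_adeleToLocal L v hH')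
    (commute_of_commute_of_isRegularElt_local L v γ hγ)
    (commute_of_commute_of_isRegularElt_local L v γ' (isRegularElt_of_isConj hc hγ))

/-- The local equivalence is conjugation by ANY `y ∈ GL_N(∏_{w∣v} L_w)` with `y γ y⁻¹ = γ′`. [cite: Rogawski1990, §4.3 pp. 43–44] -/
theorem coe_localStableCentralizerEquiv_eq_of_conj_eq (hH : H.det ≠ 0) (hH' : H'.det ≠ 0) {γ : (cmDatum L N H).Local v}
    {γ' : (cmDatum L N H').Local v}
    (hc : Corresponds (conjLocal L (IsCMField.complexConj L) v) ((adelicForm L N H).map (adeleToLocal L v))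
      ((adelicForm L N H').map (adeleToLocal L v)) γ γ')
    (hγ : IsRegularElt (γ.val : GL (Fin N) (LocalRing L v))) (y : GL (Fin N) (LocalRing L v))
    (hy : y * (γ.val : GL (Fin N) (LocalRing L v)) * y⁻¹ = γ'.val) (z : Subgroup.centralizer ({γ} : Set ((cmDatum L N H).Local v))) :
    (((localStableCentralizerEquiv L v hH hH' hc hγ z : Subgroup.centralizer ({γ'} : Set ((cmDatum L N H').Local v))) :
        (cmDatum L N H').Local v).val : GL (Fin N) (LocalRing L v)) = y * (z : (cmDatum L N H).Local v).val * y⁻¹ :=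
  conj_eq_conj_of_conj_eq (commute_of_commute_of_isRegularElt_local L v γ hγ) hc.conjugator_spec hy
    (congrArg Subtype.val (Subgroup.mem_centralizer_singleton_iff.mp z.2))

end Local

/-! ### Adelic, from rational data: `Z_{U(H)(𝔸)}(γ ⊗ 1) ≃ₜ* Z_{U(H′)(𝔸)}(γ′ ⊗ 1)` -/

section Adelic

/-- `γ ↔ γ′` over `L` (conjugate in `GL_N(L)`) ⇒ `γ ⊗ 1 ↔ γ′ ⊗ 1` over `𝔸_L` (conjugator `x ⊗ 1`). [cite: Rogawski1990, §14.1 p. 232] -/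
theorem corresponds_toAdelic {γ : (cmDatum L N H).Rational} {γ' : (cmDatum L N H').Rational} (hc : Corresponds (cmConjRingHom L) H H' γ γ') :
    Corresponds (adeleConj L) (H.map (algebraMap L (AdeleRing (𝓞 L) L))) (H'.map (algebraMap L (AdeleRing (𝓞 L) L)))
      ((cmDatum L N H).toAdelic γ) ((cmDatum L N H').toAdelic γ') := by
  obtain ⟨x, hx⟩ := isConj_iff.mp hc
  refine isConj_iff.mpr ⟨toAdeleGL L x, ?_⟩
  change toAdeleGL L x * toAdeleGL L (γ.val : GL (Fin N) L) * (toAdeleGL L x)⁻¹ = toAdeleGL L (γ'.val : GL (Fin N) L)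
  rw [← map_inv, ← map_mul, ← map_mul, hx]

/-- The `GL_N(𝔸_L)`-commutant of `γ ⊗ 1` is commutative for `γ ∈ U(H)(L⁺)` regular (★ `commute_of_commute_map_of_charpoly_separable`).
[cite: Rogawski1990, §3.1 p. 19] -/
theorem commute_of_commute_toAdelic_of_isRegularElt (γ : (cmDatum L N H).Rational) (hreg : IsRegularElt (γ.val : GL (Fin N) L)) :
    ∀ B C : Matrix (Fin N) (Fin N) (AdeleRing (𝓞 L) L),
      Commute B (((cmDatum L N H).toAdelic γ).val : GL (Fin N) (AdeleRing (𝓞 L) L)).val →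
      Commute C (((cmDatum L N H).toAdelic γ).val : GL (Fin N) (AdeleRing (𝓞 L) L)).val → Commute B C := by
  intro B C hB hC
  rw [coe_toAdelic_val_eq_map] at hB hC
  exact commute_of_commute_map_of_charpoly_separable _ hreg hB.symm hC.symm

/-- **ADELIC `Z_{U(H)(𝔸)}(γ ⊗ 1) ≃ₜ* Z_{U(H′)(𝔸)}(γ′ ⊗ 1)` from RATIONAL data**: `γ ∈ U(H)(L⁺)`, `γ′ ∈ U(H′)(L⁺)` corresponding over `L`
(conjugate in `GL_N(L)`), `γ` regular, `det H, det H′ ≠ 0` — the isomorphism of the adelic centralisers (conjugation by `x ⊗ 1`, independent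
of `x`) along which the covolumes `m(T(L⁺) \ T(𝔸))` of stably conjugate tori are compared. [cite: Rogawski1990, §4.3 pp. 43–44; §14.5 pp. 237–238] -/
def adelicStableCentralizerEquiv (hH : H.det ≠ 0) (hH' : H'.det ≠ 0) {γ : (cmDatum L N H).Rational} {γ' : (cmDatum L N H').Rational}
    (hc : Corresponds (cmConjRingHom L) H H' γ γ') (hreg : IsRegularElt (γ.val : GL (Fin N) L)) :
    Subgroup.centralizer ({(cmDatum L N H).toAdelic γ} : Set (cmDatum L N H).Adelic) ≃ₜ*
      Subgroup.centralizer ({(cmDatum L N H').toAdelic γ'} : Set (cmDatum L N H').Adelic) :=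
  (corresponds_toAdelic L hc).centralizerContinuousEquiv (isUnit_map_of_det_ne_zero L _ hH) (isUnit_map_of_det_ne_zero L _ hH')
    (commute_of_commute_toAdelic_of_isRegularElt L γ hreg)
    (commute_of_commute_toAdelic_of_isRegularElt L γ' (isRegularElt_of_isConj hc hreg))

/-- The adelic equivalence is conjugation by `y ⊗ 1` for ANY rational conjugator `y ∈ GL_N(L)`, `y γ y⁻¹ = γ′`. [cite: Rogawski1990, §4.3 pp. 43–44] -/
theorem coe_adelicStableCentralizerEquiv_eq_of_conj_eq (hH : H.det ≠ 0) (hH' : H'.det ≠ 0) {γ : (cmDatum L N H).Rational}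
    {γ' : (cmDatum L N H').Rational} (hc : Corresponds (cmConjRingHom L) H H' γ γ') (hreg : IsRegularElt (γ.val : GL (Fin N) L))
    (y : GL (Fin N) L) (hy : y * (γ.val : GL (Fin N) L) * y⁻¹ = γ'.val)
    (z : Subgroup.centralizer ({(cmDatum L N H).toAdelic γ} : Set (cmDatum L N H).Adelic)) :
    (((adelicStableCentralizerEquiv L hH hH' hc hreg z :
        Subgroup.centralizer ({(cmDatum L N H').toAdelic γ'} : Set (cmDatum L N H').Adelic)) : (cmDatum L N H').Adelic).val :
          GL (Fin N) (AdeleRing (𝓞 L) L)) = toAdeleGL L y * (z : (cmDatum L N H).Adelic).val * (toAdeleGL L y)⁻¹ := by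
  have hy' : toAdeleGL L y * (((cmDatum L N H).toAdelic γ).val : GL (Fin N) (AdeleRing (𝓞 L) L)) * (toAdeleGL L y)⁻¹ =
      (((cmDatum L N H').toAdelic γ').val : GL (Fin N) (AdeleRing (𝓞 L) L)) := by
    change toAdeleGL L y * toAdeleGL L (γ.val : GL (Fin N) L) * (toAdeleGL L y)⁻¹ = toAdeleGL L (γ'.val : GL (Fin N) L)
    rw [← map_inv, ← map_mul, ← map_mul, hy]
  exact conj_eq_conj_of_conj_eq (commute_of_commute_toAdelic_of_isRegularElt L γ hreg) (corresponds_toAdelic L hc).conjugator_spec hy'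
    (congrArg Subtype.val (Subgroup.mem_centralizer_singleton_iff.mp z.2))

/-- The `GL_N(L)`-commutant of a regular RATIONAL element is commutative (★ `commute_of_charpoly_separable`, `L` a field). [cite: Rogawski1990, §3.1 p. 19] -/
theorem commute_of_commute_of_isRegularElt_rational (γ : (cmDatum L N H).Rational) (hreg : IsRegularElt (γ.val : GL (Fin N) L)) :
    ∀ B C : Matrix (Fin N) (Fin N) L, Commute B (γ.val : GL (Fin N) L).val → Commute C (γ.val : GL (Fin N) L).val → Commute B C :=
  fun _ _ hB hC => commute_of_charpoly_separable _ hreg hB.symm hC.symm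

/-- **RATIONAL `Z_{U(H)(L⁺)}(γ) ≃* Z_{U(H′)(L⁺)}(γ′)`** for `γ ↔ γ′` over `L` (conjugate in `GL_N(L)`), `γ` regular, `det H, det H′ ≠ 0`: conjugation by a
rational conjugator `x ∈ GL_N(L)`, independent of `x`. [cite: Rogawski1990, §3.1 p. 19; §4.3 pp. 43–44] -/
def rationalStableCentralizerEquiv (hH : H.det ≠ 0) (hH' : H'.det ≠ 0) {γ : (cmDatum L N H).Rational} {γ' : (cmDatum L N H').Rational}
    (hc : Corresponds (cmConjRingHom L) H H' γ γ') (hreg : IsRegularElt (γ.val : GL (Fin N) L)) :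
    Subgroup.centralizer ({γ} : Set (cmDatum L N H).Rational) ≃* Subgroup.centralizer ({γ'} : Set (cmDatum L N H').Rational) :=
  hc.centralizerEquiv ((Matrix.isUnit_iff_isUnit_det H).mpr (isUnit_iff_ne_zero.mpr hH))
    ((Matrix.isUnit_iff_isUnit_det H').mpr (isUnit_iff_ne_zero.mpr hH'))
    (commute_of_commute_of_isRegularElt_rational L γ hreg) (commute_of_commute_of_isRegularElt_rational L γ' (isRegularElt_of_isConj hc hreg))

/-- The rational equivalence is `z ↦ x z x⁻¹` for the chosen rational conjugator `x = hc.conjugator`. [cite: Rogawski1990, §4.3 pp. 43–44] -/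
theorem coe_rationalStableCentralizerEquiv (hH : H.det ≠ 0) (hH' : H'.det ≠ 0) {γ : (cmDatum L N H).Rational} {γ' : (cmDatum L N H').Rational}
    (hc : Corresponds (cmConjRingHom L) H H' γ γ') (hreg : IsRegularElt (γ.val : GL (Fin N) L))
    (z : Subgroup.centralizer ({γ} : Set (cmDatum L N H).Rational)) :
    (((rationalStableCentralizerEquiv L hH hH' hc hreg z : Subgroup.centralizer ({γ'} : Set (cmDatum L N H').Rational)) :
        (cmDatum L N H').Rational).val : GL (Fin N) L) = hc.conjugator * (z : (cmDatum L N H).Rational).val * hc.conjugator⁻¹ :=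
  rfl

/-- `z ∈ Z_{U(H)(L⁺)}(γ)` ⇒ `z ⊗ 1 ∈ Z_{U(H)(𝔸)}(γ ⊗ 1)`. [cite: Rogawski1990, §14.5 p. 237] -/
theorem toAdelic_mem_centralizer_toAdelic {γ : (cmDatum L N H).Rational} (z : Subgroup.centralizer ({γ} : Set (cmDatum L N H).Rational)) :
    (cmDatum L N H).toAdelic (z : (cmDatum L N H).Rational) ∈
      Subgroup.centralizer ({(cmDatum L N H).toAdelic γ} : Set (cmDatum L N H).Adelic) := by
  refine Subgroup.mem_centralizer_singleton_iff.mpr ?_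
  rw [← map_mul, ← map_mul, Subgroup.mem_centralizer_singleton_iff.mp z.2]

/-- **The adelic equivalence EXTENDS the rational one**: `e_𝔸 (z ⊗ 1) = (e_L z) ⊗ 1` for `z ∈ Z_{U(H)(L⁺)}(γ)` (conjugator-independence: both are
conjugation by the rational conjugator `x ⊗ 1`) — the compatibility (M-C-4) uses to move the lattice `Z_γ(L⁺)` to `Z_{γ′}(L⁺)`. [cite: Rogawski1990, §14.5 pp. 237–238] -/
theorem adelicStableCentralizerEquiv_toAdelic (hH : H.det ≠ 0) (hH' : H'.det ≠ 0) {γ : (cmDatum L N H).Rational} {γ' : (cmDatum L N H').Rational}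
    (hc : Corresponds (cmConjRingHom L) H H' γ γ') (hreg : IsRegularElt (γ.val : GL (Fin N) L))
    (z : Subgroup.centralizer ({γ} : Set (cmDatum L N H).Rational)) :
    ((adelicStableCentralizerEquiv L hH hH' hc hreg ⟨(cmDatum L N H).toAdelic (z : (cmDatum L N H).Rational), toAdelic_mem_centralizer_toAdelic L z⟩ :
        Subgroup.centralizer ({(cmDatum L N H').toAdelic γ'} : Set (cmDatum L N H').Adelic)) : (cmDatum L N H').Adelic) =
      (cmDatum L N H').toAdelic ((rationalStableCentralizerEquiv L hH hH' hc hreg z :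
        Subgroup.centralizer ({γ'} : Set (cmDatum L N H').Rational)) : (cmDatum L N H').Rational) := by
  apply Subtype.ext
  rw [coe_adelicStableCentralizerEquiv_eq_of_conj_eq L hH hH' hc hreg hc.conjugator hc.conjugator_spec, coe_cmDatum_toAdelic,
    coe_cmDatum_toAdelic, coe_rationalStableCentralizerEquiv, map_mul, map_mul, map_inv]

/-- **The adelic equivalence carries the rational centraliser onto the rational centraliser**: `e_𝔸 z` is rational (`∈ U(H′)(L⁺) ⊗ 1`) iff `z` is
(`∈ U(H)(L⁺) ⊗ 1`) — the «`e(Γ_γ) = Γ_{γ′}`» hypothesis of ★ `quotientMeasure_univ_eq_of_mulEquiv` for the covolumes `m(Z_γ(L⁺) \ Z_γ(𝔸))`.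
[cite: Rogawski1990, §14.5 pp. 237–238] -/
theorem adelicStableCentralizerEquiv_mem_arithmeticSubgroup_iff (hH : H.det ≠ 0) (hH' : H'.det ≠ 0) {γ : (cmDatum L N H).Rational}
    {γ' : (cmDatum L N H').Rational} (hc : Corresponds (cmConjRingHom L) H H' γ γ') (hreg : IsRegularElt (γ.val : GL (Fin N) L))
    (z : Subgroup.centralizer ({(cmDatum L N H).toAdelic γ} : Set (cmDatum L N H).Adelic)) :
    adelicStableCentralizerEquiv L hH hH' hc hreg z ∈
        (cmDatum L N H').arithmeticSubgroup.subgroupOf (Subgroup.centralizer ({(cmDatum L N H').toAdelic γ'} : Set (cmDatum L N H').Adelic)) ↔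
      z ∈ (cmDatum L N H).arithmeticSubgroup.subgroupOf (Subgroup.centralizer ({(cmDatum L N H).toAdelic γ} : Set (cmDatum L N H).Adelic)) := by
  -- a rational element of an adelic centraliser of `δ ⊗ 1` comes from the rational centraliser of `δ`
  have lift : ∀ {M : Matrix (Fin N) (Fin N) L} {δ : (cmDatum L N M).Rational}
      (w : Subgroup.centralizer ({(cmDatum L N M).toAdelic δ} : Set (cmDatum L N M).Adelic)),
      (w : (cmDatum L N M).Adelic) ∈ (cmDatum L N M).arithmeticSubgroup →
        ∃ wF : Subgroup.centralizer ({δ} : Set (cmDatum L N M).Rational),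
          (cmDatum L N M).toAdelic (wF : (cmDatum L N M).Rational) = (w : (cmDatum L N M).Adelic) := by
    intro M δ w hw
    obtain ⟨wF, hwF⟩ := MonoidHom.mem_range.mp hw
    refine ⟨⟨wF, Subgroup.mem_centralizer_singleton_iff.mpr (cmDatum_toAdelic_injective L N M ?_)⟩, hwF⟩
    rw [map_mul, map_mul, hwF]
    exact Subgroup.mem_centralizer_singleton_iff.mp w.2
  constructor
  · intro h
    rw [Subgroup.mem_subgroupOf] at h ⊢
    obtain ⟨wF, hwF⟩ := lift _ h
    -- `z = (e_L⁻¹ wF) ⊗ 1`, checked after applying the injective `e_𝔸`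
    set zF : Subgroup.centralizer ({γ} : Set (cmDatum L N H).Rational) := (rationalStableCentralizerEquiv L hH hH' hc hreg).symm wF
      with hzF
    have hz : z = ⟨(cmDatum L N H).toAdelic (zF : (cmDatum L N H).Rational), toAdelic_mem_centralizer_toAdelic L zF⟩ := by
      apply (adelicStableCentralizerEquiv L hH hH' hc hreg).injective
      apply Subtype.ext
      rw [adelicStableCentralizerEquiv_toAdelic, hzF, MulEquiv.apply_symm_apply, hwF]
    rw [hz]
    exact MonoidHom.mem_range.mpr ⟨_, rfl⟩
  · intro h
    rw [Subgroup.mem_subgroupOf] at h ⊢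
    obtain ⟨zF, hzF⟩ := lift _ h
    have hz : z = ⟨(cmDatum L N H).toAdelic (zF : (cmDatum L N H).Rational), toAdelic_mem_centralizer_toAdelic L zF⟩ := Subtype.ext hzF.symm
    rw [hz, adelicStableCentralizerEquiv_toAdelic]
    exact MonoidHom.mem_range.mpr ⟨_, rfl⟩

end Adelic

/-! ### Archimedean: `U(H)(L⁺ ⊗ ℝ)`, `U(H′)(L⁺ ⊗ ℝ) ≤ GL_N(L ⊗ ℝ)` -/

section Arch

omit [NumberField L] [IsCMField L] in
/-- The coordinate ring homomorphism `L ⊗_ℚ ℝ = ℝ^{r₁} × ℂ^{r₂} →+* ℂ^{r₁ ⊔ r₂}` is injective (plumbing for the commutant brick over a ring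
embedding into a product of fields). [cite: Rogawski1990, §3.1 p. 19] -/
theorem mixedSpace_pi_injective :
    Function.Injective (RingHom.pi fun i : {w : InfinitePlace L // IsReal w} ⊕ {w : InfinitePlace L // IsComplex w} =>
      (Sum.elim (fun w => Complex.ofRealHom.comp ((Pi.evalRingHom _ w).comp (RingHom.fst _ _)))
        (fun w => (Pi.evalRingHom _ w).comp (RingHom.snd _ _)) i : mixedEmbedding.mixedSpace L →+* ℂ)) := by
  intro x y h
  refine Prod.ext (funext fun w => ?_) (funext fun w => ?_)
  · have hw : ((x.1 w : ℝ) : ℂ) = ((y.1 w : ℝ) : ℂ) := congrFun h (Sum.inl w)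
    exact Complex.ofReal_injective hw
  · exact congrFun h (Sum.inr w)

/-- The `GL_N(L ⊗ ℝ)`-commutant of a regular archimedean element is commutative (★ `commute_of_commute_of_charpoly_separable_of_injective`).
[cite: Rogawski1990, §3.1 p. 19] -/
theorem commute_of_commute_of_isRegularElt_arch (γ : arch (↥(maximalRealSubfield L)) L (IsCMField.complexConj L) N H)
    (hγ : IsRegularElt (γ.val : GL (Fin N) (mixedEmbedding.mixedSpace L))) :
    ∀ B C : Matrix (Fin N) (Fin N) (mixedEmbedding.mixedSpace L),
      Commute B (γ.val : GL (Fin N) (mixedEmbedding.mixedSpace L)).val →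
      Commute C (γ.val : GL (Fin N) (mixedEmbedding.mixedSpace L)).val → Commute B C :=
  fun _ _ hB hC => commute_of_commute_of_charpoly_separable_of_injective _ (mixedSpace_pi_injective L) hγ hB hC

/-- **ARCHIMEDEAN `Z_{G_∞}(γ) ≃ₜ* Z_{G′_∞}(γ′)`** on the `arch` carriers, for `γ ↔ γ′` (★ `Corresponds` over `L ⊗ ℝ`), `γ` regular,
`det H, det H′ ≠ 0`. [cite: Rogawski1990, §4.3 pp. 43–44] -/
def archStableCentralizerEquiv (hH : H.det ≠ 0) (hH' : H'.det ≠ 0)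
    {γ : arch (↥(maximalRealSubfield L)) L (IsCMField.complexConj L) N H} {γ' : arch (↥(maximalRealSubfield L)) L (IsCMField.complexConj L) N H'}
    (hc : Corresponds (conjMixed (↥(maximalRealSubfield L)) L (IsCMField.complexConj L)) (archFormOf L N H) (archFormOf L N H') γ γ')
    (hγ : IsRegularElt (γ.val : GL (Fin N) (mixedEmbedding.mixedSpace L))) :
    Subgroup.centralizer ({γ} : Set (arch (↥(maximalRealSubfield L)) L (IsCMField.complexConj L) N H)) ≃ₜ*
      Subgroup.centralizer ({γ'} : Set (arch (↥(maximalRealSubfield L)) L (IsCMField.complexConj L) N H')) :=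
  hc.centralizerContinuousEquiv (isUnit_map_of_det_ne_zero L _ hH) (isUnit_map_of_det_ne_zero L _ hH')
    (commute_of_commute_of_isRegularElt_arch L γ hγ) (commute_of_commute_of_isRegularElt_arch L γ' (isRegularElt_of_isConj hc hγ))

/-- The archimedean equivalence is conjugation by ANY `y ∈ GL_N(L ⊗ ℝ)` with `y γ y⁻¹ = γ′`. [cite: Rogawski1990, §4.3 pp. 43–44] -/
theorem coe_archStableCentralizerEquiv_eq_of_conj_eq (hH : H.det ≠ 0) (hH' : H'.det ≠ 0)
    {γ : arch (↥(maximalRealSubfield L)) L (IsCMField.complexConj L) N H} {γ' : arch (↥(maximalRealSubfield L)) L (IsCMField.complexConj L) N H'}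
    (hc : Corresponds (conjMixed (↥(maximalRealSubfield L)) L (IsCMField.complexConj L)) (archFormOf L N H) (archFormOf L N H') γ γ')
    (hγ : IsRegularElt (γ.val : GL (Fin N) (mixedEmbedding.mixedSpace L))) (y : GL (Fin N) (mixedEmbedding.mixedSpace L))
    (hy : y * (γ.val : GL (Fin N) (mixedEmbedding.mixedSpace L)) * y⁻¹ = γ'.val)
    (z : Subgroup.centralizer ({γ} : Set (arch (↥(maximalRealSubfield L)) L (IsCMField.complexConj L) N H))) :
    (((archStableCentralizerEquiv L hH hH' hc hγ z :
        Subgroup.centralizer ({γ'} : Set (arch (↥(maximalRealSubfield L)) L (IsCMField.complexConj L) N H'))) :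
          arch (↥(maximalRealSubfield L)) L (IsCMField.complexConj L) N H').val : GL (Fin N) (mixedEmbedding.mixedSpace L)) =
      y * (z : arch (↥(maximalRealSubfield L)) L (IsCMField.complexConj L) N H).val * y⁻¹ :=
  conj_eq_conj_of_conj_eq (commute_of_commute_of_isRegularElt_arch L γ hγ) hc.conjugator_spec hy
    (congrArg Subtype.val (Subgroup.mem_centralizer_singleton_iff.mp z.2))

end Arch

end UnitaryGroup

end Literature.NumberTheory.Automorphic
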